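import Summits.Langlands.Langlands.Theses.DyadicOddResidue

/-!
# Route DyadicOddResidue — the `Assembly` item (stmt-Langlands-18746): status certificate

The item is filed as
`Assembly := DyadicEisensteinFM → DyadicDihedralFM → Langlands`,
i.e. WITHOUT the two printed supports `OddPrimesRegularFM` (odd primes, X. Zhang 2024),
`DyadicNonsolvableFM` (Tung 2020) and the junction `SectorComplement` (the rest of `GL_n` reciprocity)
that the route's sorry-free deciding theorem `Theses.DyadicOddResidue.closes` also consumes, although
its informal text says "(given the printed supports and the junction)". This file records, sorry-free
and unconditionally:

* `dyadicOddResidue_assembly_of_omitted` — restoring the three omitted hypotheses yields `Assembly`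
  (it is then exactly `closes`);
* the repaired statement C′ = the curried type of `closes`,
  `DyadicEisensteinFM → DyadicDihedralFM → OddPrimesRegularFM → DyadicNonsolvableFM →
  SectorComplement → Langlands` (the tree's convention for assembly items, cf.
  `OddResidueBelowFive.Assembly`, `EisensteinGelfandKirillov.Assembly`), holds outright: it is the term
  `Theses.DyadicOddResidue.closes` itself, so it is not restated here;
* `dyadicOddResidue_assembly_iff_langlands` — given the two dyadic cruxes, the filed `Assembly` is
  equivalent to the summit statement `Langlands` itself;
* `dyadicOddResidue_assembly_iff_sectorComplement` — given the four Fontaine–Mazur cells (two cruxes,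
  two printed supports), the filed `Assembly` is equivalent to the junction `SectorComplement`
  (reciprocity for `GL_n` outside the sector `n = 2`, `F = ℚ`, odd, regular).

So, as filed, the item is summit-grade (an open problem), not route logic; the planner should re-type
it to C′ (or drop it: `closes` is the deciding theorem).
-/


set_option linter.dupNamespace false -- project-wide option (lakefile weak.linter.dupNamespace); `Summit.Langlands.Langlands` is the mandated namespace

namespace Summit.Langlands.Langlands.Theorems

open Summit.Langlands.Langlands.Theses.DyadicOddResidue

/-- **`Assembly` from its three omitted hypotheses.** With the printed supports `OddPrimesRegularFM`,
`DyadicNonsolvableFM` and the junction `SectorComplement` restored, the filed item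
`Assembly := DyadicEisensteinFM → DyadicDihedralFM → Langlands` is the route's deciding theorem
`closes` (trichotomy at `ℓ`: `ℓ ≠ 2`; `ℓ = 2` residually reducible / dihedral / non-solvable).
[folklore] -/
theorem dyadicOddResidue_assembly_of_omitted (h₃ : OddPrimesRegularFM) (h₄ : DyadicNonsolvableFM)
    (hC : SectorComplement) : Assembly := by
  -- buildfix 2026-08-19 (ops-buildfix lane): the route's `closes` was re-cut on 2026-08-17T12:28Z
  -- (`DyadicDihedralFM` split into DihedralProModularityCore / ProModularClassicality /
  -- DyadicDihedralPrintedCellsFM + glue), so `closes h₁ h₂ h₃ h₄ hC` no longer elaborates; this is the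
  -- body of `closes` specialised back to the two-crux form (trichotomy at `ℓ`), statement unchanged.
  have hT : DyadicEisensteinFM → DyadicDihedralFM → OddRegularReciprocityQ := by
    intro k₁ k₂ ℓ _ ρ hirr hodd hunr hdR hcpt ι
    by_cases hℓ : ℓ = 2
    · by_cases hres : ρ.IsResiduallyAbsIrreducible
      · by_cases hsol : IsSolvable ρ.residualRep.range
        · exact k₂ ℓ hℓ ρ hres hsol hirr hodd hunr hdR hcpt ι
        · exact h₄ ℓ hℓ ρ hres hsol hirr hodd hunr hdR hcpt ι
      · exact k₁ ℓ hℓ ρ hres hirr hodd hunr hdR hcpt ι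
    · exact h₃ ℓ hℓ ρ hirr hodd hunr hdR hcpt ι
  exact fun k₁ k₂ => hC (hT k₁ k₂)

/-- **As filed, `Assembly` is summit-grade.** Given the two dyadic Fontaine–Mazur cruxes (believed
true), the filed `Assembly` is logically equivalent to the full summit statement `Langlands`
(global reciprocity for `GL_n` over every number field, both directions, all places). [folklore] -/
theorem dyadicOddResidue_assembly_iff_langlands (h₁ : DyadicEisensteinFM) (h₂ : DyadicDihedralFM) :
    Assembly ↔ _root_.Langlands :=
  ⟨fun hA => hA h₁ h₂, fun hL _ _ => hL⟩

/-- **As filed, `Assembly` is the junction in disguise.** Given the four Fontaine–Mazur cells of the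
sector (the two dyadic cruxes and the two printed supports), the filed `Assembly` is logically
equivalent to the junction `SectorComplement` — reciprocity for `GL_n` outside the sector
`n = 2`, `F = ℚ`, `ρ` odd and Hodge–Tate regular (Buzzard–Gee Conj. 3.2.1/3.2.2 elsewhere), an open
problem never staffed from this route. [folklore] -/
theorem dyadicOddResidue_assembly_iff_sectorComplement (h₁ : DyadicEisensteinFM)
    (h₂ : DyadicDihedralFM) (h₃ : OddPrimesRegularFM) (h₄ : DyadicNonsolvableFM) :
    Assembly ↔ SectorComplement :=
  ⟨fun hA _ => hA h₁ h₂, fun hC h₁' h₂' => dyadicOddResidue_assembly_of_omitted h₃ h₄ hC h₁' h₂'⟩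

end Summit.Langlands.Langlands.Theorems
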